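import Summits.HodgeConjecture.HodgeConjecture.Theorems.VHCAbelianSchemesRoadAnchorReachableSeam
import HarnessLib

/-!
# Road b02 (`VHCAbelianSchemesRoad`) — `AnchorReachableAt` FROM A TWO-POINTED PENCIL WITH CLASS EXTENSION AT THE ANCHOR

research route conditional on HC_CM; not a corollary; Q11.4-sentence-2 already refuted in dim ≥ 3.

THEOREMS ONLY (door-, degree-, anchor-generic; fact-free; no `sorry`; `HC_CM` occurs nowhere). Seat core-qb gen 0 (director-hodge g16 R16.37 (2),
K0 memo `K0-2R-T-core-qb-g0.md`, evidence #50 on stmt-HodgeConjecture-26512), helper `--supports stmt-HodgeConjecture-26512` for stub 2r″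
`stub_localResidualPairs_63_OffHypDisjEndTwPrime`. Nothing here closes 2r″ or its transfer (T) (`…AnchorReachableSeam.lean` :213, displayed); the file is
the INTERFACE lemma of the D1b″ plan (LEAD 163 K0 (ρ1)–(ρ3), ring2 INBOX l.5579; b03x g16 σ1–σ3, l.5632): the reachability predicate
`AnchorReachableAt n p 𝔄 𝔘 𝔏 X w` (`…LocallyServedAnchor.lean` :124) holds as soon as one has a two-pointed pencil — a smooth projective family over a
smooth irreducible affine curve with an `𝔄`-anchor fibre `Y` at `s₁` and the target `X` at `t'` — AT WHOSE ANCHOR EVERY RATIONAL HODGE CLASS EXTENDS to a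
global class with fibrewise rational Hodge restrictions, together with a global class `G` joining a rational `w_Y ∈ 𝔏 Y θ_Y` to `w`. The extension
hypothesis `hext` is VERBATIM the shape of the field `SiegelModuliDatum.MumfordTateSubfamily.classExtends`
(`Literature/AlgebraicGeometry/ModuliOfAbelianVarieties/MumfordTateSubfamily.lean` :356; Deligne 1982 Prop. 6.1 (c) ∕ Charles–Schnell Thm. 11.5.11 (b))
transported along the anchor chart `eY`, so that a Mumford–Tate sub-family of the Siegel universal family RESTRICTED TO A CURVE through the anchor and
the target (the restriction is NOT constructed here: «irreducible curve through two points», Mumford AV §6, is absent from the tree) is consumed by name.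

* `AnchorReachableAt.of_pencil_classExtends` — generic `(n, p, 𝔄, 𝔘, 𝔏)`: the polarisation clause (`Θ'` := the extension of `θ_Y`, `q = 1`) and the
  `𝔘`-extension clause (`q = p`) of :124 are both instances of `hext`; `θ_Y` rational `(1,1)` and the rational `𝔘`-classes of type `(p,p)` are the
  only inputs beyond the pencil.
* `anchorReachableAt_63_secantQuotientPinned_of_pencil_classExtends` — the `(6,3)` instance over the PINNED secant–quotient anchors with ANY presentation
  predicate `P` (v3.11's oH, v3.12's oHE = moreover `End`-trivial, …): there `θ` is a polarisation class (rational, and `(1,1)` because supported on a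
  divisor — `isOfHodgeType_of_mem_algebraicClasses_of_isSmoothProjective`) and every pinned-served class is `(3,3)`
  (`IsSecantQuotientWeilClassAtPinned.isOfHodgeType`), exactly as in b03x's `anchorReachableAt_63_secantQuotientPinned_of_self`.

References: [Markman2025SecantWeil] §1.5, Thm. 1.5.1; [Deligne1982HodgeCycles] Prop. 6.1; [CharlesSchnell2014Notes] Thm. 11.5.11; [Andre1996Motifs] §6.3.
-/
noncomputable section

open CategoryTheory CategoryTheory.Limits AlgebraicGeometry Topology MonoidalCategory CartesianMonoidalCategory

namespace Summit.HodgeConjecture.HodgeConjecture.Ring2.SemiregularRepresentatives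

set_option linter.dupNamespace false -- the cell's namespace repeats the summit name, as in every `Ring2*` file

open Literature.AlgebraicGeometry Literature.AlgebraicGeometry.Motives Literature.AlgebraicGeometry.Motives.AbelianVariety
open Literature.AlgebraicGeometry.HodgeTheory Literature.AlgebraicGeometry.Markman2025
open Literature.AlgebraicTopology.SingularHomology

variable {n p : ℕ} {𝔄 : ∀ X : SchemeOver ℂ, complexBetti X 2 → Prop}
  {𝔘 𝔏 : ∀ (X : SchemeOver ℂ), complexBetti X 2 → Set (complexBetti X (2 * p))}

/-- **Reachability from a two-pointed pencil with class extension at the anchor** (the interface of the D1b″ plan): a smooth projective family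
`f' : 𝒳' ⟶ S'` of relative dimension `n` (quasi-projective total space) over a smooth irreducible affine curve, an `𝔄`-anchor `(Y, θ_Y)` charted on
the fibre at `s₁` with `θ_Y` rational of type `(1,1)` and the rational `𝔘 Y θ_Y`-classes of type `(p,p)`, the target `X` charted on the fibre at `t'`,
the EXTENSION PROPERTY AT THE ANCHOR «every rational `(q,q)` class on `Y` is the restriction at `s₁` of a global class with fibrewise rational `(q,q)`
restrictions» (the shape of `SiegelModuliDatum.MumfordTateSubfamily.classExtends`, Deligne 1982 Prop. 6.1 (c)), and a global class `G` joining a rational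
`w_Y ∈ 𝔏 Y θ_Y` to `w` — give `AnchorReachableAt n p 𝔄 𝔘 𝔏 X w`: the polarisation clause is `hext` at `q = 1` on `θ_Y`, the `𝔘`-clause is `hext` at
`q = p`. [cite: Markman2025SecantWeil, §1.5 and Thm. 1.5.1] [cite: Deligne1982HodgeCycles, Prop. 6.1] [cite: CharlesSchnell2014Notes, Thm. 11.5.11] -/
theorem AnchorReachableAt.of_pencil_classExtends {𝒳' S' : SchemeOver ℂ} (f' : 𝒳' ⟶ S') (hf' : IsSmoothProjectiveFamily f' n)
    (h𝒳' : IsQuasiProjectiveOver 𝒳') [IrreducibleSpace S'.left] [IsAffine S'.left] (hS' : AlgebraicGeometry.Smooth S'.hom)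
    (hdim : topologicalKrullDim S'.left = 1) (s₁ t' : ComplexPoints S') {Y X : SchemeOver ℂ} {θY : complexBetti Y 2}
    (eY : fiberOver f' s₁ ≅ Y) (eX : fiberOver f' t' ≅ X) (hY : 𝔄 Y θY) (hθQ : IsRationalClass θY) (hθH : IsOfHodgeType n Y 2 1 1 θY)
    (h𝔘 : ∀ u ∈ 𝔘 Y θY, IsRationalClass u → IsOfHodgeType n Y (2 * p) p p u)
    (hext : ∀ (q : ℕ) (c : complexBetti Y (2 * q)), IsRationalClass c → IsOfHodgeType n Y (2 * q) q q c →
      ∃ W : complexBetti 𝒳' (2 * q),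
        (∀ u : ComplexPoints S', IsRationalClass (complexBetti.map (fiberι f' u) (2 * q) W) ∧
          IsOfHodgeType n (fiberOver f' u) (2 * q) q q (complexBetti.map (fiberι f' u) (2 * q) W)) ∧
        complexBetti.map (fiberι f' s₁) (2 * q) W = complexBetti.map eY.hom (2 * q) c)
    {wY : complexBetti Y (2 * p)} (hwY : wY ∈ 𝔏 Y θY) (hwYQ : IsRationalClass wY) (G : complexBetti 𝒳' (2 * p))
    (hGs₁ : complexBetti.map (fiberι f' s₁) (2 * p) G = complexBetti.map eY.hom (2 * p) wY) {w : complexBetti X (2 * p)}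
    (hGt' : complexBetti.map (fiberι f' t') (2 * p) G = complexBetti.map eX.hom (2 * p) w) :
    AnchorReachableAt n p 𝔄 𝔘 𝔏 X w := by
  -- the polarisation clause: extend `θ_Y` (degree `2 = 2 * 1`)
  obtain ⟨Θ', hΘ', hΘ's₁⟩ := hext 1 θY hθQ hθH
  refine ⟨𝒳', S', f', s₁, t', Y, θY, eY, eX, Θ', wY, G, hf', h𝒳', ‹_›, ‹_›, hS', hdim, hY, fun u ↦ (hΘ' u).1, fun u ↦ (hΘ' u).2,
    hΘ's₁, fun u₀ hu₀ hu₀Q ↦ ?_, hwY, hwYQ, hGs₁, hGt'⟩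
  -- the `𝔘`-clause: extend each rational `u₀ ∈ 𝔘 Y θ_Y` (degree `2 * p`)
  obtain ⟨Gu, hGu, hGus₁⟩ := hext p u₀ hu₀Q (h𝔘 u₀ hu₀ hu₀Q)
  exact ⟨Gu, hGus₁, fun u ↦ (hGu u).2⟩

/-- **The `(6,3)` instance over the PINNED secant–quotient anchors, any presentation predicate `P`** (v3.11's oH: non-hyperelliptic ∧
`OrbitTranslatesDisjoint` ∧ pin; v3.12's oHE: moreover `End`-trivial; …): a two-pointed pencil of abelian-sixfold type (relative dimension `6`) whose
anchor fibre is a presented pinned anchor `(Y, θ)` AT WHICH EVERY RATIONAL HODGE CLASS EXTENDS fibrewise-Hodge, with a global class joining a rational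
`w_Y ∈ 𝔖^pin(Y, θ) + ℂθ³` (or `ℂθ³`) to `w`, makes `(X, w)` anchor-reachable for that family — `θ` is rational `(1,1)` (`IsPolarizationClass`, supported
on a divisor of the smooth projective `Y ≅ Y_d`) and the pinned-served directions are `(3,3)`, so `AnchorReachableAt.of_pencil_classExtends` applies.
This is the form in which a Mumford–Tate sub-family of the Siegel universal family through an `End`-trivial anchor, restricted to a curve through the
target, would discharge the transfer (T) of `localResidualPairs_63_offHypDisjEnd_of_offHypDisj_of_transfer` — the curve and the sub-family are NOT
constructed here. [cite: Markman2025SecantWeil, §1.5 (p. 7) and Thm. 1.4.1] [cite: Deligne1982HodgeCycles, Prop. 6.1] [cite: Andre1996Motifs, §6.3] -/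
theorem anchorReachableAt_63_secantQuotientPinned_of_pencil_classExtends {P : ∀ Y : SchemeOver ℂ, complexBetti Y 2 → Prop}
    {𝒳' S' : SchemeOver ℂ} (f' : 𝒳' ⟶ S') (hf' : IsSmoothProjectiveFamily f' 6) (h𝒳' : IsQuasiProjectiveOver 𝒳')
    [IrreducibleSpace S'.left] [IsAffine S'.left] (hS' : AlgebraicGeometry.Smooth S'.hom) (hdim : topologicalKrullDim S'.left = 1)
    (s₁ t' : ComplexPoints S') {Y X : SchemeOver ℂ} {θ : complexBetti Y 2} (eY : fiberOver f' s₁ ≅ Y) (eX : fiberOver f' t' ≅ X)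
    (hY : secantQuotientAnchorsPinned Y θ ∧ P Y θ)
    (hext : ∀ (q : ℕ) (c : complexBetti Y (2 * q)), IsRationalClass c → IsOfHodgeType 6 Y (2 * q) q q c →
      ∃ W : complexBetti 𝒳' (2 * q),
        (∀ u : ComplexPoints S', IsRationalClass (complexBetti.map (fiberι f' u) (2 * q) W) ∧
          IsOfHodgeType 6 (fiberOver f' u) (2 * q) q q (complexBetti.map (fiberι f' u) (2 * q) W)) ∧
        complexBetti.map (fiberι f' s₁) (2 * q) W = complexBetti.map eY.hom (2 * q) c)
    {wY : complexBetti Y (2 * 3)}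
    (hwY : wY ∈ {w | ∃ γ, (γ = 0 ∨ γ ∈ secantQuotientServedClassesPinned Y θ) ∧ ∃ z : ℂ, w = γ + z • cupPowTwo θ 3})
    (hwYQ : IsRationalClass wY) (G : complexBetti 𝒳' (2 * 3))
    (hGs₁ : complexBetti.map (fiberι f' s₁) (2 * 3) G = complexBetti.map eY.hom (2 * 3) wY) {w : complexBetti X (2 * 3)}
    (hGt' : complexBetti.map (fiberι f' t') (2 * 3) G = complexBetti.map eX.hom (2 * 3) w) :
    AnchorReachableAt 6 3 (fun Y θ ↦ secantQuotientAnchorsPinned Y θ ∧ P Y θ)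
      (fun Y θ ↦ secantQuotientServedClassesPinned Y θ)
      (fun Y θ ↦ {w | ∃ γ, (γ = 0 ∨ γ ∈ secantQuotientServedClassesPinned Y θ) ∧ ∃ z : ℂ, w = γ + z • cupPowTwo θ 3}) X w := by
  obtain ⟨γ₀, D, e, θ₀, -, -, hpol, -⟩ := hY.1
  have hYsp : IsSmoothProjective 6 Y := D.isSmoothProjective_Y.of_iso e.symm
  exact AnchorReachableAt.of_pencil_classExtends (𝔄 := fun Y θ ↦ secantQuotientAnchorsPinned Y θ ∧ P Y θ)
    (𝔘 := fun Y θ ↦ secantQuotientServedClassesPinned Y θ)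
    (𝔏 := fun Y θ ↦ {w | ∃ γ, (γ = 0 ∨ γ ∈ secantQuotientServedClassesPinned Y θ) ∧ ∃ z : ℂ, w = γ + z • cupPowTwo θ 3})
    f' hf' h𝒳' hS' hdim s₁ t' eY eX hY hpol.isRationalClass
    (isOfHodgeType_of_mem_algebraicClasses_of_isSmoothProjective hYsp 1 hpol.mem_algebraicClasses)
    (fun u hu _ ↦ IsSecantQuotientWeilClassAtPinned.isOfHodgeType hu) hext hwY hwYQ G hGs₁ hGt'

end Summit.HodgeConjecture.HodgeConjecture.Ring2.SemiregularRepresentatives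

end
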